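/-
Copyright (c) 2026 the pub-hodgecm-mathlib formalisation cell (harness21).  Prover seat hodgecm-mathlib-K2Liu-p05 (g4), 2026-09-04
(Track B «K2-LIT», crux hLiu418 = stmt-HodgeConjecture-24832, LEAD F0P6-plan (g13) RULING M-157d organ (K∞-str), file F1 = the GENERIC ENGINE:
a right-finite continuous function on a compact group lies in any dense, translation-stable, *-stable finite-dimensional filtration).
-/
import Literature.RepresentationTheory.CompactGroups.CharacterCompleteness      -- ★ `eq_zero_of_orthogonal_separating_family`
import Literature.RepresentationTheory.CompactGroups.UnitaryTrick                -- ★ `CompactGroup.isMulRightInvariant_of_isHaarMeasure` (compact ⇒ unimodular)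
import Mathlib.MeasureTheory.Group.Integral
import Mathlib.LinearAlgebra.Dual.Lemmas
import HarnessLib

/-!
# (K∞-str, F1) Right-finite continuous functions on a compact group lie in every dense translation-stable filtration

Track B ∕ K2-LIT, hLiu418 = stmt-HodgeConjecture-24832; LEAD F0P6-plan (g13) RULING M-157d «(K∞-str) IS AN ORGAN OF RECORD, TYPED ONCE, GENERIC» (consumers:
the A∞ faces, #42S step S2, (β5)).  Namespace `Summit.HodgeConjecture.HodgeConjecture.Cruxes.HLiu418.K2LiuCompactGroupFiniteFunctions`.  THEOREMS ONLY (no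
definition, no instance, no notation, no named fact, no `sorry`); `--supports stmt-HodgeConjecture-24832 --as helper`.

THE ENGINE (abstract form of «`K`-finite ⇒ polynomial»).  `G` is a compact Hausdorff group with a finite, right-invariant Borel measure `μ` positive on
non-empty open sets (its Haar measure); `A : ℕ → Submodule ℂ C(G, ℂ)` is a MONOTONE FILTRATION by FINITE-DIMENSIONAL subspaces, each stable under LEFT and
RIGHT translation and under `star`, whose union contains `1`, is closed under products and SEPARATES POINTS (model: polynomial functions of degree `≤ d` in the
matrix entries and their conjugates on a compact subgroup of `U(m)`, file F2).  THEN EVERY CONTINUOUS `f` WHOSE RIGHT TRANSLATES SPAN A FINITE-DIMENSIONAL SPACE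
LIES IN SOME `A d` (`exists_mem_of_finiteDimensional_span_rightTranslates`).

PROOF («projection stabilisation»; no irreducibles, no unitarisation, no Schur).  With the BILINEAR pairing `B(a, u) = ∫ a·u dμ`:
* §1 `B` is right-invariant up to inversion (`integral_mul_comp_mulRight`: `∫ a(x) u(xk) = ∫ a(xk⁻¹) u(x)`), and NON-DEGENERATE on `star`-stable subspaces
  (`eq_zero_of_integral_star_mul_self`: `∫ ā·a = 0 ⇒ a = 0`, the measure being positive on opens); a finite-dimensional space of continuous functions is
  determined on a finite set of points (`exists_finset_determining`, the `ℂ`-twin of ★ `TranslationFinite`'s lemma);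
* §2 for `W` = span of the right translates of `f`, the annihilators `K_d = W ∩ A_d^{⊥_B}` decrease with `d`, hence stabilise (`W` is finite-dimensional) at
  `W ∩ (⋃ A_d)^{⊥_B}`, which is `0` by ★ `eq_zero_of_orthogonal_separating_family` (Stone–Weierstrass); so at that level `d₀` the `B`-orthogonal projection
  `T : W → A_{d₀}` (it exists: `a′ ↦ B(·, a′)` is an isomorphism `A_{d₀} ≅ A_{d₀}^*` by non-degeneracy and `dim A^* = dim A`) is an INJECTIVE RIGHT-EQUIVARIANT
  linear map into a space of functions; finally the matrix-coefficient trick: `f(k) = (R_k f)(1)`, and the functional `w ↦ w(1)` on `W` factors through the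
  point values of `T w` on a determining finite set `s` of `A_{d₀}`, so `f = Σ_{y ∈ s} c_y · L_y(T f) ∈ A_{d₀}`.

HONEST LABEL: HC_CM is proved only modulo the 7 printed citations (2 remaining named inputs: hLiu418 = stmt-HodgeConjecture-24832, h413 =
stmt-HodgeConjecture-24833) until rung 0 closes; organ capital, moves no counter.

## References
[BrockerTomDieck1985] T. Bröcker, T. tom Dieck, *Representations of Compact Lie Groups*, GTM 98 (1985), III (1.2)–(1.5), III Thm. (3.1), III (4.1) ·
[Chevalley1946] C. Chevalley, *Theory of Lie Groups I* (1946), Ch. VI §VIII (representative functions of a compact linear group are polynomial) ·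
[Folland1995] G. B. Folland, *A Course in Abstract Harmonic Analysis* (1995), Thm. 5.11.
-/

set_option autoImplicit false
set_option linter.dupNamespace false

noncomputable section

open scoped ComplexConjugate
open MeasureTheory

namespace Summit.HodgeConjecture.HodgeConjecture.Cruxes.HLiu418.K2LiuCompactGroupFiniteFunctions

/-! ## §1 The bilinear Haar pairing `B(a,u) = ∫ a·u dμ`: invariance, non-degeneracy; determining finite sets -/

section Pairing

variable {G : Type*} [Group G] [TopologicalSpace G] [IsTopologicalGroup G] [CompactSpace G]
  [MeasurableSpace G] [BorelSpace G] (μ : Measure G) [IsFiniteMeasure μ]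

omit [Group G] [IsTopologicalGroup G] in
/-- products of continuous functions on a compact group are integrable for a finite measure. [folklore] -/
theorem integrable_mul (a u : C(G, ℂ)) : Integrable (fun x => a x * u x) μ :=
  (a.continuous.mul u.continuous).integrable_of_hasCompactSupport (HasCompactSupport.of_compactSpace _)

omit [CompactSpace G] [IsFiniteMeasure μ] in
/-- **right invariance of the pairing**: `∫ a(x) · u(x k) dμ = ∫ a(x k⁻¹) · u(x) dμ` for a right-invariant `μ`. [cite: BrockerTomDieck1985, III (4.1)] -/
theorem integral_mul_comp_mulRight [μ.IsMulRightInvariant] (a u : C(G, ℂ)) (k : G) :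
    ∫ x, a x * u (x * k) ∂μ = ∫ x, a (x * k⁻¹) * u x ∂μ := by
  have h := integral_mul_right_eq_self (μ := μ) (fun x => a (x * k⁻¹) * u x) k
  simp only [mul_inv_cancel_right] at h
  exact h

omit [Group G] [IsTopologicalGroup G] [BorelSpace G] in
/-- **non-degeneracy**: for a finite measure positive on non-empty open sets, `∫ star a · a dμ = 0` forces the continuous `a` to vanish. [folklore] -/
theorem eq_zero_of_integral_star_mul_self [OpensMeasurableSpace G] [μ.IsOpenPosMeasure] (a : C(G, ℂ))
    (h : ∫ x, star (a x) * a x ∂μ = 0) : a = 0 := by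
  have h1 : (fun x => star (a x) * a x) = fun x => (((‖a x‖ ^ 2 : ℝ)) : ℂ) := by
    funext x
    rw [Complex.star_def, Complex.conj_mul']
    push_cast
    rfl
  rw [h1, integral_complex_ofReal, Complex.ofReal_eq_zero] at h
  have hnn : 0 ≤ fun x => ‖a x‖ ^ 2 := fun x => by positivity
  have hint : Integrable (fun x => ‖a x‖ ^ 2) μ :=
    ((continuous_norm.comp a.continuous).pow 2).integrable_of_hasCompactSupport (HasCompactSupport.of_compactSpace _)
  have hae := (integral_eq_zero_iff_of_nonneg hnn hint).mp h
  have hzero : (fun x => ‖a x‖ ^ 2) = fun _ => (0 : ℝ) :=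
    (Continuous.ae_eq_iff_eq μ ((continuous_norm.comp a.continuous).pow 2) continuous_const).mp hae
  ext x
  have hx := congrFun hzero x
  simp only [ne_eq, OfNat.ofNat_ne_zero, not_false_eq_true, pow_eq_zero_iff, norm_eq_zero] at hx
  rw [hx, ContinuousMap.zero_apply]

omit [Group G] [IsTopologicalGroup G] [CompactSpace G] [MeasurableSpace G] [BorelSpace G] in
/-- **a finite-dimensional space of continuous functions is determined on a finite set of points** (the `ℂ`-twin of ★ `Submodule.exists_finset_determining`:
induction on the dimension). [cite: BrockerTomDieck1985, III (1.5)] -/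
theorem exists_finset_determining (F : Submodule ℂ C(G, ℂ)) [FiniteDimensional ℂ F] :
    ∃ s : Finset G, ∀ f ∈ F, (∀ x ∈ s, f x = 0) → f = 0 := by
  suffices h : ∀ n, ∀ K : Submodule ℂ C(G, ℂ), K ≤ F → Module.finrank ℂ K = n →
      ∃ s : Finset G, ∀ f ∈ K, (∀ x ∈ s, f x = 0) → f = 0 from
    h _ F le_rfl rfl
  intro n
  induction n using Nat.strong_induction_on with
  | _ n ih =>
    intro K hKF hKn
    haveI : FiniteDimensional ℂ K := Submodule.finiteDimensional_of_le hKF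
    by_cases hK : K = ⊥
    · refine ⟨∅, fun f hf _ => ?_⟩
      rw [hK, Submodule.mem_bot] at hf
      exact hf
    · obtain ⟨f₀, hf₀K, hf₀⟩ := (Submodule.ne_bot_iff K).mp hK
      obtain ⟨x₀, hx₀⟩ : ∃ x₀, f₀ x₀ ≠ 0 := by
        by_contra! h
        exact hf₀ (ContinuousMap.ext h)
      let ev : C(G, ℂ) →ₗ[ℂ] ℂ :=
        { toFun := fun f => f x₀, map_add' := fun _ _ => rfl, map_smul' := fun _ _ => rfl }
      set K' : Submodule ℂ C(G, ℂ) := K ⊓ LinearMap.ker ev with hK'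
      have hlt : K' < K := by
        refine lt_of_le_of_ne inf_le_left fun heq => hx₀ ?_
        have : f₀ ∈ K' := heq ▸ hf₀K
        exact this.2
      have hrank : Module.finrank ℂ K' < n := hKn ▸ Submodule.finrank_lt_finrank_of_lt hlt
      obtain ⟨s', hs'⟩ := ih _ hrank K' (inf_le_left.trans hKF) rfl
      classical
      refine ⟨insert x₀ s', fun f hfK hzero => ?_⟩
      have hfK' : f ∈ K' := ⟨hfK, hzero x₀ (Finset.mem_insert_self _ _)⟩
      exact hs' f hfK' fun x hx => hzero x (Finset.mem_insert_of_mem hx)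

end Pairing

/-! ## §2 The engine -/

section Engine

variable {G : Type*} [Group G] [TopologicalSpace G] [IsTopologicalGroup G] [CompactSpace G] [MeasurableSpace G] [BorelSpace G]

/-- **RIGHT-FINITE CONTINUOUS FUNCTIONS LIE IN EVERY DENSE TRANSLATION-STABLE FILTRATION.**  Let `G` be a compact group (with its Borel σ-algebra), and `A : ℕ → Submodule ℂ C(G, ℂ)` a monotone filtration by finite-dimensional subspaces, each stable under left translation
`a ↦ a(y ·)`, right translation `a ↦ a(· k)` and `star`, whose union contains `1`, is closed under products and separates the points of `G`.  Then every `f ∈ C(G, ℂ)`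
whose right translates `f(· k)` span a finite-dimensional space lies in `A d` for some `d`.  (Projection stabilisation: the `B`-annihilators `W ∩ A_d^⊥` of the span `W`
of the right translates vanish for large `d` by ★ `eq_zero_of_orthogonal_separating_family`; the `B`-orthogonal projection `W → A_d` is then an injective
right-equivariant map into functions, and `f(k) = (R_k f)(1)` is read off finitely many point values of it.) [cite: BrockerTomDieck1985, III (1.2)–(1.5), Thm. (3.1)]
[cite: Chevalley1946, Ch. VI §VIII] -/
theorem exists_mem_of_finiteDimensional_span_rightTranslates (A : ℕ → Submodule ℂ C(G, ℂ)) (hmono : Monotone A)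
    (hfin : ∀ d, FiniteDimensional ℂ (A d))
    (hleft : ∀ d (y : G) (a : C(G, ℂ)), a ∈ A d → a.comp (ContinuousMap.mulLeft y) ∈ A d)
    (hright : ∀ d (k : G) (a : C(G, ℂ)), a ∈ A d → a.comp (ContinuousMap.mulRight k) ∈ A d)
    (hstar : ∀ d (a : C(G, ℂ)), a ∈ A d → star a ∈ A d)
    (hone : ∃ d, (1 : C(G, ℂ)) ∈ A d)
    (hmul : ∀ d d' (a b : C(G, ℂ)), a ∈ A d → b ∈ A d' → ∃ d'', a * b ∈ A d'')
    (hsep : ∀ x y : G, x ≠ y → ∃ d, ∃ a ∈ A d, a x ≠ a y)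
    (f : C(G, ℂ)) (hf : FiniteDimensional ℂ (Submodule.span ℂ (Set.range fun k : G => f.comp (ContinuousMap.mulRight k)))) :
    ∃ d, f ∈ A d := by
  classical
  -- the tool: a Haar measure `μ` (finite, positive on opens, RIGHT-invariant since compact groups are unimodular)
  haveI : LocallyCompactSpace G := Literature.RepresentationTheory.CompactGroups.CompactGroup.locallyCompactSpace_of_compactSpace_group
  set μ : Measure G := Measure.haarMeasure (⊤ : TopologicalSpace.PositiveCompacts G) with hμ
  haveI : μ.IsMulRightInvariant := Literature.RepresentationTheory.CompactGroups.CompactGroup.isMulRightInvariant_of_isHaarMeasure μ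
  -- the span `W` of the right translates, right-stable and containing `f`
  set W : Submodule ℂ C(G, ℂ) := Submodule.span ℂ (Set.range fun k : G => f.comp (ContinuousMap.mulRight k)) with hWdef
  haveI : FiniteDimensional ℂ W := hf
  have hfW : f ∈ W := by
    refine Submodule.subset_span ⟨1, ?_⟩
    ext x
    simp only [ContinuousMap.comp_apply, ContinuousMap.coe_mulRight, mul_one]
  have hWright : ∀ (k : G) (u : C(G, ℂ)), u ∈ W → u.comp (ContinuousMap.mulRight k) ∈ W := by
    intro k u hu
    induction hu using Submodule.span_induction with
    | mem u hu =>
      obtain ⟨g, rfl⟩ := hu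
      refine Submodule.subset_span ⟨k * g, ?_⟩
      ext x
      simp only [ContinuousMap.comp_apply, ContinuousMap.coe_mulRight, mul_assoc]
    | zero => exact Submodule.zero_mem _
    | add u v _ _ hu hv => exact Submodule.add_mem _ hu hv
    | smul c u _ hu => exact Submodule.smul_mem _ c hu
  -- the pairing functionals `B a = ∫ a · (−) dμ`
  let B : C(G, ℂ) → (C(G, ℂ) →ₗ[ℂ] ℂ) := fun a =>
    { toFun := fun u => ∫ x, a x * u x ∂μ
      map_add' := fun u v => by
        simp only [ContinuousMap.add_apply, mul_add]
        exact integral_add (integrable_mul μ a u) (integrable_mul μ a v)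
      map_smul' := fun c u => by
        simp only [ContinuousMap.smul_apply, smul_eq_mul, RingHom.id_apply, mul_left_comm (a _) c, integral_const_mul] }
  have hB : ∀ a u : C(G, ℂ), B a u = ∫ x, a x * u x ∂μ := fun a u => rfl
  have hBsymm : ∀ a u : C(G, ℂ), B a u = B u a := fun a u => by simp only [hB, mul_comm]
  have hBadd : ∀ a b u : C(G, ℂ), B (a + b) u = B a u + B b u := fun a b u => by
    rw [hBsymm, map_add, hBsymm u a, hBsymm u b]
  have hBsmul : ∀ (c : ℂ) (a u : C(G, ℂ)), B (c • a) u = c * B a u := fun c a u => by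
    rw [hBsymm, map_smul, smul_eq_mul, hBsymm u a]
  -- the annihilators `K d = W ∩ A_d^⊥`, antitone in `d`
  let K : ℕ → Submodule ℂ C(G, ℂ) := fun d => W ⊓ ⨅ a : A d, LinearMap.ker (B (a : C(G, ℂ)))
  have hKmem : ∀ d (u : C(G, ℂ)), u ∈ K d ↔ u ∈ W ∧ ∀ a ∈ A d, B a u = 0 := fun d u => by
    simp only [K, Submodule.mem_inf, Submodule.mem_iInf, LinearMap.mem_ker, Subtype.forall]
  have hKanti : ∀ {d d'}, d ≤ d' → K d' ≤ K d := fun {d d'} hdd' u hu => by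
    rw [hKmem] at hu ⊢
    exact ⟨hu.1, fun a ha => hu.2 a (hmono hdd' ha)⟩
  have hKW : ∀ d, K d ≤ W := fun d => inf_le_left
  -- stabilisation of the dimensions
  obtain ⟨d₁, hd₁⟩ : ∃ d₁, ∀ d, d₁ ≤ d → K d = K d₁ := by
    have hne : (Set.range fun d => Module.finrank ℂ (K d)).Nonempty := Set.range_nonempty _
    obtain ⟨d₁, hd₁⟩ : ∃ d₁, Module.finrank ℂ (K d₁) = sInf (Set.range fun d => Module.finrank ℂ (K d)) := Nat.sInf_mem hne
    refine ⟨d₁, fun d hd => ?_⟩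
    haveI : FiniteDimensional ℂ (K d₁) := Submodule.finiteDimensional_of_le (hKW d₁)
    refine Submodule.eq_of_le_of_finrank_eq (hKanti hd) (le_antisymm (Submodule.finrank_mono (hKanti hd)) ?_)
    rw [hd₁]
    exact Nat.sInf_le ⟨d, rfl⟩
  -- the stable annihilator is `0` (Stone–Weierstrass: nothing continuous is orthogonal to a separating *-algebra)
  obtain ⟨d₂, hd₂⟩ := hone
  set d₀ := max d₁ d₂ with hd₀def
  have hKd₀ : ∀ u : C(G, ℂ), u ∈ K d₀ → u = 0 := by
    intro u hu
    have hall : ∀ d, ∀ a ∈ A d, B a u = 0 := by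
      intro d a ha
      have hu' : u ∈ K (max d d₀) := by
        rw [hd₁ (max d d₀) ((le_max_left _ _).trans (le_max_right d d₀)), ← hd₁ d₀ (le_max_left _ _)]
        exact hu
      exact ((hKmem _ u).1 hu').2 a (hmono (le_max_left d d₀) ha)
    refine Literature.RepresentationTheory.CompactGroups.eq_zero_of_orthogonal_separating_family μ (⋃ d, (A d : Set C(G, ℂ)))
      (Set.mem_iUnion.2 ⟨d₂, hd₂⟩) (fun s hs t ht => ?_) (fun s hs => ?_) (fun x y hxy => ?_) u (fun s hs => ?_)
    · obtain ⟨d, hd⟩ := Set.mem_iUnion.1 hs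
      obtain ⟨d', hd'⟩ := Set.mem_iUnion.1 ht
      obtain ⟨d'', h''⟩ := hmul d d' s t hd hd'
      exact Set.mem_iUnion.2 ⟨d'', h''⟩
    · obtain ⟨d, hd⟩ := Set.mem_iUnion.1 hs
      exact Set.mem_iUnion.2 ⟨d, hstar d s hd⟩
    · obtain ⟨d, a, ha, hne⟩ := hsep x y hxy
      exact ⟨a, Set.mem_iUnion.2 ⟨d, ha⟩, hne⟩
    · obtain ⟨d, hd⟩ := Set.mem_iUnion.1 hs
      exact hall d (star s) (hstar d s hd)
  -- the level `d₀`: `A₀ := A d₀`, finite-dimensional, and `B` is non-degenerate on it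
  haveI hA₀fin : FiniteDimensional ℂ (A d₀) := hfin d₀
  let Θ : A d₀ →ₗ[ℂ] Module.Dual ℂ (A d₀) :=
    { toFun := fun a' => (B (a' : C(G, ℂ))).domRestrict (A d₀)
      map_add' := fun a b => by
        refine LinearMap.ext fun c => ?_
        simp only [LinearMap.domRestrict_apply, Submodule.coe_add, LinearMap.add_apply, hBadd]
      map_smul' := fun z a => by
        refine LinearMap.ext fun c => ?_
        simp only [LinearMap.domRestrict_apply, Submodule.coe_smul, LinearMap.smul_apply, RingHom.id_apply, smul_eq_mul, hBsmul] }
  have hΘ : ∀ (a' c : A d₀), Θ a' c = B (a' : C(G, ℂ)) (c : C(G, ℂ)) := fun a' c => rfl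
  have hΘinj : Function.Injective Θ := by
    refine (injective_iff_map_eq_zero Θ).mpr fun a' ha' => ?_
    have h0 : B (a' : C(G, ℂ)) (star (a' : C(G, ℂ))) = 0 := by
      have := LinearMap.congr_fun ha' ⟨star (a' : C(G, ℂ)), hstar d₀ _ a'.2⟩
      rwa [hΘ, LinearMap.zero_apply] at this
    rw [hBsymm, hB] at h0
    exact Subtype.ext (eq_zero_of_integral_star_mul_self μ (a' : C(G, ℂ)) h0)
  have hΘbij : Function.Bijective Θ :=
    ⟨hΘinj, (LinearMap.injective_iff_surjective_of_finrank_eq_finrank (Subspace.dual_finrank_eq).symm).mp hΘinj⟩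
  let Θe : A d₀ ≃ₗ[ℂ] Module.Dual ℂ (A d₀) := LinearEquiv.ofBijective Θ hΘbij
  -- the `B`-orthogonal projection `T : W → A₀`
  let Q : W →ₗ[ℂ] Module.Dual ℂ (A d₀) :=
    { toFun := fun u => (B (u : C(G, ℂ))).domRestrict (A d₀)
      map_add' := fun u v => by
        refine LinearMap.ext fun c => ?_
        simp only [LinearMap.domRestrict_apply, Submodule.coe_add, LinearMap.add_apply, hBadd]
      map_smul' := fun z u => by
        refine LinearMap.ext fun c => ?_
        simp only [LinearMap.domRestrict_apply, Submodule.coe_smul, LinearMap.smul_apply, RingHom.id_apply, smul_eq_mul, hBsmul] }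
  let T : W →ₗ[ℂ] A d₀ := Θe.symm.toLinearMap.comp Q
  have hT : ∀ (u : W) (a : C(G, ℂ)), a ∈ A d₀ → B (T u : C(G, ℂ)) a = B (u : C(G, ℂ)) a := by
    intro u a ha
    have h1 : Θe (T u) = Q u := Θe.apply_symm_apply (Q u)
    have h2 := LinearMap.congr_fun h1 ⟨a, ha⟩
    exact h2
  -- `T` is injective (the stable annihilator vanishes) …
  have hTinj : Function.Injective T := by
    refine (injective_iff_map_eq_zero T).mpr fun u hu => ?_
    have hu0 : (u : C(G, ℂ)) ∈ K d₀ := by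
      rw [hKmem]
      refine ⟨u.2, fun a ha => ?_⟩
      rw [hBsymm, ← hT u a ha, hu, Submodule.coe_zero, hB]
      simp only [ContinuousMap.zero_apply, zero_mul, integral_zero]
    exact Subtype.ext (hKd₀ _ hu0)
  -- … and right-equivariant
  have hTequiv : ∀ (u : W) (k : G),
      (T ⟨(u : C(G, ℂ)).comp (ContinuousMap.mulRight k), hWright k _ u.2⟩ : C(G, ℂ)) =
        (T u : C(G, ℂ)).comp (ContinuousMap.mulRight k) := by
    intro u k
    have hmem : (T u : C(G, ℂ)).comp (ContinuousMap.mulRight k) ∈ A d₀ := hright d₀ k _ (T u).2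
    suffices h : T ⟨(u : C(G, ℂ)).comp (ContinuousMap.mulRight k), hWright k _ u.2⟩ = ⟨_, hmem⟩ from congrArg Subtype.val h
    apply hΘinj
    refine LinearMap.ext fun c => ?_
    rw [hΘ, hΘ, hT _ _ c.2]
    change B ((u : C(G, ℂ)).comp (ContinuousMap.mulRight k)) (c : C(G, ℂ)) =
      B ((T u : C(G, ℂ)).comp (ContinuousMap.mulRight k)) (c : C(G, ℂ))
    have hck : (c : C(G, ℂ)).comp (ContinuousMap.mulRight k⁻¹) ∈ A d₀ := hright d₀ k⁻¹ _ c.2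
    have hshift : ∀ v : C(G, ℂ), B (v.comp (ContinuousMap.mulRight k)) (c : C(G, ℂ)) =
        B v ((c : C(G, ℂ)).comp (ContinuousMap.mulRight k⁻¹)) := fun v => by
      rw [hBsymm, hBsymm v]
      simp only [hB, ContinuousMap.comp_apply, ContinuousMap.coe_mulRight]
      exact integral_mul_comp_mulRight μ _ v k
    rw [hshift, hshift, hT u _ hck]
  -- a determining finite set for `A₀`, and the left inverse of `res ∘ T`
  obtain ⟨s, hs⟩ := exists_finset_determining (A d₀)
  let res : A d₀ →ₗ[ℂ] (s → ℂ) :=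
    { toFun := fun a y => (a : C(G, ℂ)) y, map_add' := fun _ _ => rfl, map_smul' := fun _ _ => rfl }
  have hresT : Function.Injective (res.comp T) := by
    refine (injective_iff_map_eq_zero _).mpr fun u hu => hTinj ?_
    rw [map_zero]
    exact Subtype.ext (hs _ (T u).2 fun y hy => congrFun hu ⟨y, hy⟩)
  obtain ⟨L, hL⟩ := LinearMap.exists_leftInverse_of_injective (res.comp T) (LinearMap.ker_eq_bot.mpr hresT)
  -- the coefficients `c y = (L δ_y)(1)` read `w(1)` off the values of `T w` on `s`
  have hexp : ∀ w : W, (w : C(G, ℂ)) 1 = ∑ y : s, (T w : C(G, ℂ)) y * (L (Pi.single y 1) : C(G, ℂ)) 1 := by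
    intro w
    have h1 : L (res (T w)) = w := by
      have := LinearMap.congr_fun hL w
      simpa only [LinearMap.comp_apply, LinearMap.id_apply] using this
    have h2 : res (T w) = ∑ y : s, (T w : C(G, ℂ)) y • (Pi.single y (1 : ℂ) : s → ℂ) := by
      rw [pi_eq_sum_univ (res (T w))]
      refine Finset.sum_congr rfl fun y _ => ?_
      have hsingle : (fun j : s => if y = j then (1 : ℂ) else 0) = Pi.single y 1 := by
        ext j; simp [Pi.single_apply, eq_comm]
      rw [hsingle]
      rfl
    conv_lhs => rw [← h1, h2]
    simp only [map_sum, map_smul, Submodule.coe_sum, Submodule.coe_smul, ContinuousMap.coe_sum, Finset.sum_apply,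
      ContinuousMap.coe_smul, Pi.smul_apply, smul_eq_mul]
  -- conclusion: `f = Σ_y c_y · L_y (T f)`
  refine ⟨d₀, ?_⟩
  have hf_eq : f = ∑ y : s, (L (Pi.single y 1) : C(G, ℂ)) 1 • ((T ⟨f, hfW⟩ : C(G, ℂ)).comp (ContinuousMap.mulLeft (y : G))) := by
    ext k
    have hk := hexp ⟨f.comp (ContinuousMap.mulRight k), hWright k f hfW⟩
    simp only [ContinuousMap.comp_apply, ContinuousMap.coe_mulRight, one_mul] at hk
    rw [hk, ContinuousMap.coe_sum, Finset.sum_apply]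
    refine Finset.sum_congr rfl fun y _ => ?_
    rw [hTequiv ⟨f, hfW⟩ k]
    simp only [ContinuousMap.coe_smul, ContinuousMap.comp_apply, ContinuousMap.coe_mulRight,
      ContinuousMap.coe_mulLeft, Pi.smul_apply, smul_eq_mul, mul_comm]
  rw [hf_eq]
  exact Submodule.sum_mem _ fun y _ => Submodule.smul_mem _ _ (hleft d₀ (y : G) _ (T ⟨f, hfW⟩).2)

end Engine

end Summit.HodgeConjecture.HodgeConjecture.Cruxes.HLiu418.K2LiuCompactGroupFiniteFunctions

end
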